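import Literature.Geometry.Lorentzian.BogovskiiDoubleDivergence
import HarnessLib

/-!
# The classical form of the Bogovskiĭ-type kernel

(trunk G08 = T-LORENTZ; family `gr`; namespace `Literature.Geometry.Lorentzian.MaoOhTao`.)

Mao–Oh–Tao (arXiv:2308.13031), Lemma 2.3, writes the kernel of `S` as
`Ψ^{ij}_η(z + y, y) = (∫_{|z|}^∞ η(r z/|z| + y) r² dr) zⁱzʲ/|z|³` (the weight is `bogovskiiWeight`).  Substituting
`r = s|z|` gives the classical Bogovskiĭ form (M. E. Bogovskiĭ 1979; Galdi, *An introduction to the mathematical theory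
of the Navier–Stokes equations*, III.3, for the divergence equation)

  `Ψ^{ij}_η(z + y, y) = zⁱ zʲ ∫_1^∞ η(y + s z) s² ds`,  `w_y(|z|, z/|z|) = |z|³ ∫_1^∞ η(y + s z) s² ds`  (`z ≠ 0`),

in which the kernel is visibly smooth in `(z, y)` off `z = 0` and homogeneous of degree `−1` up to the smooth factor —
the form under which the `H^s`-mapping properties (S3), (S4) are classically derived.  This file proves the two identities
(`bogovskiiWeight_norm_eq`, `bogovskiiKernel_eq_classical`).

Everything is proved; no definitions, no named facts.

## References

* Y. Mao, S.-J. Oh, T. Tao, arXiv:2308.13031 (2023), Lemma 2.3, p. 8 (key `MaoOhTao2023`).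
-/

noncomputable section

open scoped RealInnerProductSpace Topology
open Filter MeasureTheory Set Metric Function

namespace Literature.Geometry.Lorentzian

namespace MaoOhTao

variable {η : E3 → ℝ}

/-- **The weight in classical form**: `w_y(|z|, z/|z|) = |z|³ ∫_1^∞ η(s z + y) s² ds` for `z ≠ 0` (substitute `r = s|z|`).
[folklore] -/
theorem bogovskiiWeight_norm_eq (η : E3 → ℝ) (y : E3) {z : E3} (hz : z ≠ 0) :
    bogovskiiWeight η y ‖z‖ (‖z‖⁻¹ • z) = ‖z‖ ^ 3 * ∫ s in Ioi (1 : ℝ), η (s • z + y) * s ^ 2 := by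
  have hn : 0 < ‖z‖ := norm_pos_iff.2 hz
  have key := integral_comp_mul_left_Ioi (fun r : ℝ ↦ η (r • (‖z‖⁻¹ • z) + y) * r ^ 2) 1 hn
  rw [mul_one] at key
  -- `key : ∫ t in Ioi 1, g(|z| t) = |z|⁻¹ • w`
  have hg : ∀ t : ℝ, η ((‖z‖ * t) • (‖z‖⁻¹ • z) + y) * (‖z‖ * t) ^ 2 = ‖z‖ ^ 2 * (η (t • z + y) * t ^ 2) := by
    intro t
    rw [smul_smul, show ‖z‖ * t * ‖z‖⁻¹ = t by field_simp]
    ring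
  simp only [hg] at key
  rw [integral_const_mul, smul_eq_mul] at key
  show ∫ s in Ioi ‖z‖, η (s • (‖z‖⁻¹ • z) + y) * s ^ 2 = ‖z‖ ^ 3 * ∫ s in Ioi (1 : ℝ), η (s • z + y) * s ^ 2
  have h : ∫ x in Ioi ‖z‖, η (x • ‖z‖⁻¹ • z + y) * x ^ 2 = ‖z‖ * (‖z‖ ^ 2 * ∫ a in Ioi 1, η (a • z + y) * a ^ 2) := by
    rw [key, ← mul_assoc, mul_inv_cancel₀ hn.ne', one_mul]
  rw [h]
  ring

/-- **The kernel in classical form**: `Ψ^{ij}_η(z + y, y) = w_y zⁱzʲ/|z|³ = zⁱ zʲ ∫_1^∞ η(s z + y) s² ds` (both sides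
vanish at `z = 0`). [folklore] -/
theorem bogovskiiKernel_eq_classical (η : E3 → ℝ) (y z : E3) (i j : Fin 3) :
    bogovskiiWeight η y ‖z‖ (‖z‖⁻¹ • z) * (z i * (z j * (‖z‖ ^ 3)⁻¹)) =
      z i * z j * ∫ s in Ioi (1 : ℝ), η (s • z + y) * s ^ 2 := by
  by_cases hz : z = 0
  · subst hz; simp
  have hn : 0 < ‖z‖ := norm_pos_iff.2 hz
  rw [bogovskiiWeight_norm_eq η y hz]
  field_simp

/-- The vector kernel likewise: `w_y zⁱ/|z|³ = zⁱ ∫_1^∞ η(s z + y) s² ds`. [folklore] -/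
theorem bogovskiiV_eq_classical (η : E3 → ℝ) (y z : E3) (i : Fin 3) :
    bogovskiiWeight η y ‖z‖ (‖z‖⁻¹ • z) * (z i * (‖z‖ ^ 3)⁻¹) = z i * ∫ s in Ioi (1 : ℝ), η (s • z + y) * s ^ 2 := by
  by_cases hz : z = 0
  · subst hz; simp
  have hn : 0 < ‖z‖ := norm_pos_iff.2 hz
  rw [bogovskiiWeight_norm_eq η y hz]
  field_simp

end MaoOhTao

end Literature.Geometry.Lorentzian

end
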